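import Summits.QuantumFields.YangMills.Theorems.ThermodynamicCeilingsCanonicalSpectralClauses
import HarnessLib

/-!
# (Part 2 of 2 — LANDING SPLIT) §3 the pure-analysis anchor bound and §4 the «wuc certificate» `spectralAnchor_of_topBandPointCeiling`
# of LINE g16-2 «SpectralAnchor» (crux ⟨stmt-QuantumFields-27770⟩); imports Part 1 `ThermodynamicCeilingsCanonicalSpectralClauses`

Author: planner ym-idea-11 g16 (file `ideators/ym-idea-11/g16/landing/ThermodynamicCeilingsCanonicalSpectralDefs.lean`, sha16 afdaf23bcaa066a4).
Landed as a landing service by lead seat `ym-line-sfw-p2` g75 (cell ym-idea-1); second namespace BYTE-IDENTICAL (plus one one-line docstring the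
lint requires).  This module keeps the NAME the planner's import-swap skeletons import and re-exports Part 1 through its import.  The author's
header follows unchanged.  HONEST LABEL: analysis lemmas + a necessity certificate between OPEN statements; no crux, rung, leaf or summit
statement is proved; the Yang–Mills mass gap is NOT proved.
-/


/-!
# Currency + analysis module of LINES «CanonicalSpectralClauses» (g16-1, crux ⟨stmt-QuantumFields-28158⟩
# `ThermodynamicCeilings.AnchoredSpectralMeasure`, skeleton 3fb89ed6) and «SpectralAnchor» (g16-2, crux
# ⟨stmt-QuantumFields-27770⟩ `ThermodynamicCeilings.TopBandPointCeiling`, skeleton REV 3) — planner ym-idea-11 g16;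
# critic idea-crit-9 VERDICT #87 P3 / VERDICT #88 P3–P4 («land ONE shared sorry-free support module; both Lines files import it»).

This file is the sorry-free part of the two REGISTERED skeletons `ideators/ym-idea-11/g16/canonical-spectral-clauses.lean` and
`ideators/ym-idea-11/g16/spectral-anchor.lean`, CHARACTER-FOR-CHARACTER and in the SAME namespaces
`Summit.QuantumFields.YangMills.Cruxes.AnchoredSpectralMeasure.CanonicalSpectralClauses` /
`Summit.QuantumFields.YangMills.Cruxes.TopBandPointCeiling.SpectralAnchor`, so that every stub landing
(`stub_anchoredMajorant`, `stub_laplaceUV` — ∀L form registered on 28158, C″ form `2ℓ ≤ s·L` registered on 27770 — and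
`stub_spectralAnchor` on 27770) and both skeletons import ONE set of constants (no FQN re-declaration across tree files):

* §0 the hypothesis blocks `Floors`, `OnsetMax` (28158 / 27770 verbatim), `NearOnset` (27770 verbatim);
* §1 the CANONICAL WITNESS `canMeasure` / `canConstant` := Literature `plaquetteSpectralMeasure` / `plaquetteSpectralConstant` of
  `r.ρ` on the odd torus `2L+1`, axis `k` moved to slot 0; the clause shapes `Majorant`, `LaplaceUV` (+ monotonicity in `A`);
* §2 PROVED: `canonical_representation` — clause (i) of 28158 for the canonical witness (finite, supported in (0,∞), κ₀ ≥ 0, and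
  the reflected Laplace representation of the on-axis mirror covariance for 2 ≤ t ≤ 2L−1), from the landed Literature theorem
  `plaquette_pair_spectral_representation`;
* §3 PROVED (pure real analysis): `laplace_anchor_upper` / `representation_anchor_upper` — ∫ e^{−Eτ} dν ≤ (1 + 2A·16⁸ + A²8⁸e²)·ν([0,x₀))
  for a finite measure on (0,∞) with the one-anchor degree-8 majorant on [x₀,1] and the Laplace-UV clause, whenever τ ≥ 3, x₀τ ≥ 1
  (layer cake + `majorant_restrict`, `pow_eight_le_exp_half`, `pow_eight_exp_le`, `lintegral_exp_neg_log_half`); `anchorConst`, `anchor_arith`;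
* §4 PROVED: the «wuc certificate» `spectralAnchor_of_topBandPointCeiling` — `TopBandPointCeiling` (27770) implies the spectral IR
  anchor S1 (κ₀ + ν_can([0,E₀)) ≤ (e^{3/2}C/R₂⁴)², E₀ = max(s/ℓ, 4/L)) under 27770's own hypotheses (necessity half: a refutation of
  S1 refutes 27770 — negative-knowledge routing).

Author: planner ym-idea-11 g16 (to be landed unchanged as a landing service, pattern ✓p711383).  HONEST LABEL: currency +
glue/analysis lemmas; no crux, rung, leaf or summit statement is proved by this file; the Yang–Mills mass gap is NOT proved.

References: Montvay–Münster (1994) §1.5.2, §3.5 [MontvayMunster1994]; Osterwalder–Seiler 1978 §3 [OsterwalderSeiler1978];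
Lüscher 1977 [Luscher1977]; Glimm–Jaffe 1987 §6.1 [GlimmJaffe1987].
-/

set_option autoImplicit false


noncomputable section

open MeasureTheory Filter Topology
open Literature.MathematicalPhysics.QuantumFieldTheory Literature.MathematicalPhysics.QuantumLattice
open Summit.QuantumFields.YangMills.Cruxes.OSLegsFromFemtoAndGap.DlrCollarTransfer

/-! ## LINE g16-2 proper: the spectral anchor for `TopBandPointCeiling` -/

namespace Summit.QuantumFields.YangMills.Cruxes.TopBandPointCeiling.SpectralAnchor

open Set
open Summit.QuantumFields.YangMills.Cruxes.AnchoredSpectralMeasure.CanonicalSpectralClauses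
open Summit.QuantumFields.YangMills.Cruxes.ScaleMonotonicity.Spectral (exp_integrable laplace_layer_cake cum_zero)
open Summit.QuantumFields.YangMills.Cruxes.ScaleMonotonicity.SpectralW (restrict_Iic_zero pow_eight_exp_le)
open Summit.QuantumFields.YangMills.Cruxes.ScaleMonotonicity.SpectralEdge (lintegral_exp_neg_log_half)
open Summit.QuantumFields.YangMills.Cruxes.ScaleMonotonicity.SpectralA (pow_eight_le_exp_half majorant_restrict)

/-! ### Pure real analysis: the anchor upper bound -/

/-- **Anchor upper bound for Laplace transforms** (pure real analysis).  For a finite measure `ν` on `(0,∞)` obeying the one-anchor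
degree-8 majorant on `[x₀, 1]` and the Laplace-UV clause with constant `A ≥ 1`, at any time `τ ≥ 3` with `x₀τ ≥ 1`:
`∫ e^{−Eτ} dν ≤ (1 + 2A·16⁸ + A²·8⁸·e²) · ν([0,x₀))`.  Layer cake below the cutoff (`(−log σ)⁸ ≤ 16⁸ σ^{−1/2}`), the UV clause and
`τ⁸e^{−(τ−2)} ≤ 8⁸e²` above it.  [cite: GlimmJaffe1987, §6.1] -/
theorem laplace_anchor_upper (ν : Measure ℝ) [IsFiniteMeasure ν] (hsupp : ν (Iic 0) = 0) (A x₀ : ℝ) (hA : 1 ≤ A)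
    (hx₀ : 0 < x₀) (hx₀1 : x₀ ≤ 1)
    (hmaj : ∀ E : ℝ, x₀ ≤ E → E ≤ 1 → (ν (Iio E)).toReal ≤ A * (E / x₀) ^ 8 * (ν (Iio x₀)).toReal)
    (huv : (∫ E in Ici (1 : ℝ), Real.exp (-(2 * E)) ∂ν) ≤ A * (ν (Iio 1)).toReal)
    (τ : ℝ) (hτ : 3 ≤ τ) (h1 : 1 ≤ x₀ * τ) :
    ∫ E, Real.exp (-(E * τ)) ∂ν ≤ (1 + 2 * A * 16 ^ 8 + A ^ 2 * 8 ^ 8 * Real.exp 2) * (ν (Iio x₀)).toReal := by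
  have hA0 : 0 ≤ A := by linarith
  have hτ0 : 0 < τ := by linarith
  set m : ENNReal := ν (Iio x₀) with hm
  have hmtop : m ≠ ⊤ := measure_ne_top ν _
  have hm0 : 0 ≤ m.toReal := ENNReal.toReal_nonneg
  set ν₁ : Measure ℝ := ν.restrict (Iio 1) with hν₁
  set ν₂ : Measure ℝ := ν.restrict (Ici 1) with hν₂
  have hsupp₁ : ν₁ (Iic 0) = 0 := restrict_Iic_zero ν hsupp _
  have hsupp₂ : ν₂ (Iic 0) = 0 := restrict_Iic_zero ν hsupp _
  have hsplit : ν₁ + ν₂ = ν := by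
    rw [hν₁, hν₂, ← compl_Iio, Measure.restrict_add_restrict_compl measurableSet_Iio]
  have hres : ∀ y : ℝ, ν₁ (Iio y) = ν (Iio (min y 1)) := fun y => by
    rw [hν₁, Measure.restrict_apply measurableSet_Iio, Iio_inter_Iio]
  have hm₁ : ν₁ (Iio x₀) = m := by rw [hres, min_eq_left hx₀1]
  -- unbounded-range majorant for `ν₁`
  have hmaj₁ : ∀ E : ℝ, x₀ ≤ E → (ν₁ (Iio E)).toReal ≤ A * (E / x₀) ^ 8 * (ν₁ (Iio x₀)).toReal :=
    majorant_restrict ν A x₀ hA hx₀ hx₀1 hmaj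
  /- (a) the part below the cutoff: layer cake -/
  have hconv : ∫ E, Real.exp (-(E * τ)) ∂ν₁ = (∫⁻ E, ENNReal.ofReal (Real.exp (-(E * τ))) ∂ν₁).toReal :=
    integral_eq_lintegral_of_nonneg_ae (Filter.Eventually.of_forall fun E => (Real.exp_pos _).le)
      (by fun_prop : Continuous fun E : ℝ => Real.exp (-(E * τ))).aestronglyMeasurable
  rw [laplace_layer_cake ν₁ τ hτ0] at hconv
  have hmajE : ∀ E : ℝ, x₀ ≤ E → ν₁ (Iio E) ≤ ENNReal.ofReal (A * (E / x₀) ^ 8) * m := by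
    intro E hE
    have h := hmaj₁ E hE
    rw [hm₁] at h
    calc ν₁ (Iio E) = ENNReal.ofReal ((ν₁ (Iio E)).toReal) := (ENNReal.ofReal_toReal (measure_ne_top ν₁ _)).symm
      _ ≤ ENNReal.ofReal (A * (E / x₀) ^ 8 * m.toReal) := ENNReal.ofReal_le_ofReal h
      _ = ENNReal.ofReal (A * (E / x₀) ^ 8) * ENNReal.ofReal m.toReal := by
          rw [ENNReal.ofReal_mul (by positivity)]
      _ = ENNReal.ofReal (A * (E / x₀) ^ 8) * m := by rw [ENNReal.ofReal_toReal hmtop]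
  set K : ℝ := A * 16 ^ 8 / (τ * x₀) ^ 8 with hK
  have hτx : 0 < τ * x₀ := mul_pos hτ0 hx₀
  have hK0 : 0 ≤ K := by positivity
  have hpt : ∀ σ ∈ Ioi (0:ℝ), ν₁ (Iio (-Real.log σ / τ)) ≤
      (Ioo (0:ℝ) 1).indicator (fun σ => m * ENNReal.ofReal (1 + K * Real.exp (-Real.log σ / 2))) σ := by
    intro σ hσ
    have hσ0 : (0:ℝ) < σ := hσ
    by_cases h1σ : σ < 1
    · rw [indicator_of_mem (show σ ∈ Ioo (0:ℝ) 1 from ⟨hσ0, h1σ⟩)]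
      have hlog : Real.log σ ≤ 0 := Real.log_nonpos hσ0.le h1σ.le
      set y := -Real.log σ with hy
      have hy0 : 0 ≤ y := by rw [hy]; linarith
      have hone : (1 : ENNReal) ≤ ENNReal.ofReal (1 + K * Real.exp (y / 2)) := by
        rw [← ENNReal.ofReal_one]
        exact ENNReal.ofReal_le_ofReal (by nlinarith [Real.exp_pos (y / 2)])
      by_cases hEx : x₀ ≤ y / τ
      · have h := hmajE (y / τ) hEx
        have hy8 := pow_eight_le_exp_half y hy0
        have hfrac : A * (y / τ / x₀) ^ 8 ≤ K * Real.exp (y / 2) := by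
          have e1 : (y / τ / x₀) ^ 8 = y ^ 8 / (τ * x₀) ^ 8 := by rw [div_div, div_pow]
          rw [e1, hK]
          rw [show A * (y ^ 8 / (τ * x₀) ^ 8) = A / (τ * x₀) ^ 8 * y ^ 8 by ring,
            show A * 16 ^ 8 / (τ * x₀) ^ 8 * Real.exp (y / 2) = A / (τ * x₀) ^ 8 * (16 ^ 8 * Real.exp (y / 2)) by ring]
          exact mul_le_mul_of_nonneg_left hy8 (by positivity)
        calc ν₁ (Iio (y / τ)) ≤ ENNReal.ofReal (A * (y / τ / x₀) ^ 8) * m := h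
          _ ≤ ENNReal.ofReal (K * Real.exp (y / 2)) * m := by gcongr
          _ ≤ ENNReal.ofReal (1 + K * Real.exp (y / 2)) * m := by
              gcongr; linarith
          _ = m * ENNReal.ofReal (1 + K * Real.exp (y / 2)) := mul_comm _ _
      · push Not at hEx
        calc ν₁ (Iio (y / τ)) ≤ ν₁ (Iio x₀) := measure_mono (Iio_subset_Iio hEx.le)
          _ = m := hm₁
          _ = m * 1 := (mul_one m).symm
          _ ≤ m * ENNReal.ofReal (1 + K * Real.exp (y / 2)) := by gcongr
    · push Not at h1σ
      rw [indicator_of_notMem (fun h : σ ∈ Ioo (0:ℝ) 1 => (not_lt.2 h1σ) h.2)]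
      have hlog : 0 ≤ Real.log σ := Real.log_nonneg h1σ
      have : -Real.log σ / τ ≤ 0 := div_nonpos_of_nonpos_of_nonneg (by linarith) hτ0.le
      rw [cum_zero ν₁ hsupp₁ _ this]
  have hint : ∫⁻ σ in Ioi (0:ℝ), ν₁ (Iio (-Real.log σ / τ)) ≤
      m * (ENNReal.ofReal 1 + ENNReal.ofReal K * ENNReal.ofReal 2) := by
    calc ∫⁻ σ in Ioi (0:ℝ), ν₁ (Iio (-Real.log σ / τ))
        ≤ ∫⁻ σ in Ioi (0:ℝ), (Ioo (0:ℝ) 1).indicator (fun σ => m * ENNReal.ofReal (1 + K * Real.exp (-Real.log σ / 2))) σ :=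
          setLIntegral_mono' measurableSet_Ioi hpt
      _ = ∫⁻ σ in Ioo (0:ℝ) 1, m * ENNReal.ofReal (1 + K * Real.exp (-Real.log σ / 2)) := by
          rw [lintegral_indicator measurableSet_Ioo, Measure.restrict_restrict measurableSet_Ioo,
            show Ioo (0:ℝ) 1 ∩ Ioi 0 = Ioo 0 1 from inter_eq_left.mpr Ioo_subset_Ioi_self]
      _ = m * ∫⁻ σ in Ioo (0:ℝ) 1, ENNReal.ofReal (1 + K * Real.exp (-Real.log σ / 2)) :=
          lintegral_const_mul' m _ hmtop
      _ = m * ∫⁻ σ in Ioo (0:ℝ) 1, (ENNReal.ofReal 1 + ENNReal.ofReal K * ENNReal.ofReal (Real.exp (-Real.log σ / 2))) := by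
          congr 1
          refine setLIntegral_congr_fun measurableSet_Ioo (fun σ _ => ?_)
          rw [ENNReal.ofReal_add zero_le_one (by positivity), ENNReal.ofReal_mul hK0]
      _ = m * (ENNReal.ofReal 1 * volume (Ioo (0:ℝ) 1) +
            ENNReal.ofReal K * ∫⁻ σ in Ioo (0:ℝ) 1, ENNReal.ofReal (Real.exp (-Real.log σ / 2))) := by
          rw [lintegral_add_left measurable_const, setLIntegral_const,
            lintegral_const_mul' _ _ ENNReal.ofReal_ne_top]
      _ = m * (ENNReal.ofReal 1 + ENNReal.ofReal K * ENNReal.ofReal 2) := by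
          rw [Real.volume_Ioo, lintegral_exp_neg_log_half, sub_zero, ENNReal.ofReal_one, mul_one]
  have hne2 : ENNReal.ofReal 1 + ENNReal.ofReal K * ENNReal.ofReal 2 ≠ ⊤ :=
    ENNReal.add_ne_top.2 ⟨ENNReal.ofReal_ne_top, ENNReal.mul_ne_top ENNReal.ofReal_ne_top ENNReal.ofReal_ne_top⟩
  have hup₁ : ∫ E, Real.exp (-(E * τ)) ∂ν₁ ≤ m.toReal * (1 + 2 * K) := by
    rw [hconv]
    calc (∫⁻ σ in Ioi (0:ℝ), ν₁ (Iio (-Real.log σ / τ))).toReal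
        ≤ (m * (ENNReal.ofReal 1 + ENNReal.ofReal K * ENNReal.ofReal 2)).toReal :=
          ENNReal.toReal_mono (ENNReal.mul_ne_top hmtop hne2) hint
      _ = m.toReal * (1 + 2 * K) := by
          rw [ENNReal.toReal_mul, ENNReal.toReal_add ENNReal.ofReal_ne_top
              (ENNReal.mul_ne_top ENNReal.ofReal_ne_top ENNReal.ofReal_ne_top),
            ENNReal.toReal_mul, ENNReal.toReal_ofReal zero_le_one, ENNReal.toReal_ofReal hK0,
            ENNReal.toReal_ofReal zero_le_two]
          ring
  have hKle : K ≤ A * 16 ^ 8 := by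
    rw [hK, div_le_iff₀ (by positivity)]
    have : (1:ℝ) ≤ (τ * x₀) ^ 8 := one_le_pow₀ (by nlinarith [mul_comm x₀ τ])
    nlinarith [show (0:ℝ) ≤ A * 16 ^ 8 by positivity]
  have ha : ∫ E, Real.exp (-(E * τ)) ∂ν₁ ≤ (1 + 2 * A * 16 ^ 8) * m.toReal := by
    refine le_trans hup₁ ?_
    have : m.toReal * (1 + 2 * K) ≤ m.toReal * (1 + 2 * (A * 16 ^ 8)) :=
      mul_le_mul_of_nonneg_left (by linarith) hm0
    linarith
  /- (b) the part above the cutoff -/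
  have hI₂ : Integrable (fun E : ℝ => Real.exp (-(E * τ))) ν₂ := exp_integrable ν₂ hsupp₂ τ hτ0.le
  have hI2 : Integrable (fun E : ℝ => Real.exp (-(τ - 2)) * Real.exp (-(2 * E))) ν₂ := by
    have h := (exp_integrable ν₂ hsupp₂ 2 (by norm_num)).const_mul (Real.exp (-(τ - 2)))
    refine h.congr (Filter.Eventually.of_forall fun E => ?_)
    simp only [mul_comm E 2]
  have hb1 : ∫ E, Real.exp (-(E * τ)) ∂ν₂ ≤ ∫ E, Real.exp (-(τ - 2)) * Real.exp (-(2 * E)) ∂ν₂ := by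
    rw [hν₂]
    refine setIntegral_mono_on hI₂ hI2 measurableSet_Ici ?_
    intro E hE
    have hE1 : (1:ℝ) ≤ E := hE
    rw [← Real.exp_add]
    exact Real.exp_le_exp.2 (by nlinarith)
  have hb2 : ∫ E, Real.exp (-(τ - 2)) * Real.exp (-(2 * E)) ∂ν₂ = Real.exp (-(τ - 2)) * ∫ E in Ici (1:ℝ), Real.exp (-(2 * E)) ∂ν := by
    rw [integral_const_mul]
  have hν1m : (ν (Iio 1)).toReal ≤ A * (1 / x₀) ^ 8 * m.toReal := hmaj 1 (by linarith) le_rfl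
  have hx8 : (1 / x₀) ^ 8 ≤ τ ^ 8 := by
    have h' : 1 / x₀ ≤ τ := by rw [div_le_iff₀ hx₀]; linarith [mul_comm x₀ τ]
    exact pow_le_pow_left₀ (by positivity) h' 8
  have hτ8 := pow_eight_exp_le τ hτ0.le
  have hb : ∫ E, Real.exp (-(E * τ)) ∂ν₂ ≤ A ^ 2 * 8 ^ 8 * Real.exp 2 * m.toReal := by
    have e0 : 0 < Real.exp (-(τ - 2)) := Real.exp_pos _
    calc ∫ E, Real.exp (-(E * τ)) ∂ν₂ ≤ Real.exp (-(τ - 2)) * ∫ E in Ici (1:ℝ), Real.exp (-(2 * E)) ∂ν := by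
          rw [← hb2]; exact hb1
      _ ≤ Real.exp (-(τ - 2)) * (A * (ν (Iio 1)).toReal) := mul_le_mul_of_nonneg_left huv e0.le
      _ ≤ Real.exp (-(τ - 2)) * (A * (A * (1 / x₀) ^ 8 * m.toReal)) := by gcongr
      _ ≤ Real.exp (-(τ - 2)) * (A * (A * τ ^ 8 * m.toReal)) := by gcongr
      _ = A ^ 2 * m.toReal * (τ ^ 8 * Real.exp (-(τ - 2))) := by ring
      _ ≤ A ^ 2 * m.toReal * (8 ^ 8 * Real.exp 2) := mul_le_mul_of_nonneg_left hτ8 (by positivity)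
      _ = A ^ 2 * 8 ^ 8 * Real.exp 2 * m.toReal := by ring
  /- sum -/
  have hI₁ : Integrable (fun E : ℝ => Real.exp (-(E * τ))) ν₁ := exp_integrable ν₁ hsupp₁ τ hτ0.le
  have hsum : ∫ E, Real.exp (-(E * τ)) ∂ν = ∫ E, Real.exp (-(E * τ)) ∂ν₁ + ∫ E, Real.exp (-(E * τ)) ∂ν₂ := by
    conv_lhs => rw [← hsplit]
    exact integral_add_measure hI₁ hI₂
  rw [hsum]
  have : (1 + 2 * A * 16 ^ 8) * m.toReal + A ^ 2 * 8 ^ 8 * Real.exp 2 * m.toReal =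
      (1 + 2 * A * 16 ^ 8 + A ^ 2 * 8 ^ 8 * Real.exp 2) * m.toReal := by ring
  linarith

/-- The constant of the anchor upper bound for the two-sided (reflected) representation, `1 + 2(1 + 2A·16⁸ + A²8⁸e²)`. -/
def anchorConst (A : ℝ) : ℝ := 1 + 2 * (1 + 2 * A * 16 ^ 8 + A ^ 2 * 8 ^ 8 * Real.exp 2)

/-- `anchorConst A ≥ 1` for `A ≥ 1`. -/
theorem one_le_anchorConst (A : ℝ) (hA : 1 ≤ A) : 1 ≤ anchorConst A := by
  unfold anchorConst; have := Real.exp_pos 2; nlinarith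

/-- **Two-sided form**: `κ₀ + ∫ (e^{−Eτ} + e^{−Eσ}) dν ≤ anchorConst A · (κ₀ + ν([0,x₀)))` for `3 ≤ τ ≤ σ`, `x₀τ ≥ 1`, `κ₀ ≥ 0`. -/
theorem representation_anchor_upper (ν : Measure ℝ) [IsFiniteMeasure ν] (hsupp : ν (Iic 0) = 0) (κ₀ A x₀ : ℝ)
    (hκ₀ : 0 ≤ κ₀) (hA : 1 ≤ A) (hx₀ : 0 < x₀) (hx₀1 : x₀ ≤ 1)
    (hmaj : ∀ E : ℝ, x₀ ≤ E → E ≤ 1 → (ν (Iio E)).toReal ≤ A * (E / x₀) ^ 8 * (ν (Iio x₀)).toReal)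
    (huv : (∫ E in Ici (1 : ℝ), Real.exp (-(2 * E)) ∂ν) ≤ A * (ν (Iio 1)).toReal)
    (τ σ : ℝ) (hτ : 3 ≤ τ) (hτσ : τ ≤ σ) (h1 : 1 ≤ x₀ * τ) :
    κ₀ + ∫ E, (Real.exp (-(E * τ)) + Real.exp (-(E * σ))) ∂ν ≤ anchorConst A * (κ₀ + (ν (Iio x₀)).toReal) := by
  have hτ0 : 0 ≤ τ := by linarith
  have hσ0 : 0 ≤ σ := by linarith
  have hIτ := exp_integrable ν hsupp τ hτ0
  have hIσ := exp_integrable ν hsupp σ hσ0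
  have hae : ∀ᵐ E ∂ν, 0 < E := by
    have h : ∀ᵐ E ∂ν, E ∉ Iic (0:ℝ) := compl_mem_ae_iff.mpr hsupp
    filter_upwards [h] with E hE
    exact not_le.mp hE
  have hmono : ∫ E, Real.exp (-(E * σ)) ∂ν ≤ ∫ E, Real.exp (-(E * τ)) ∂ν := by
    refine integral_mono_ae hIσ hIτ ?_
    filter_upwards [hae] with E hE
    exact Real.exp_le_exp.2 (by nlinarith)
  have hup := laplace_anchor_upper ν hsupp A x₀ hA hx₀ hx₀1 hmaj huv τ hτ h1
  have hm0 : 0 ≤ (ν (Iio x₀)).toReal := ENNReal.toReal_nonneg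
  have hK1 : 1 ≤ anchorConst A := one_le_anchorConst A hA
  rw [integral_add hIτ hIσ]
  unfold anchorConst at *
  have hpos : 0 ≤ (1 + 2 * A * 16 ^ 8 + A ^ 2 * 8 ^ 8 * Real.exp 2) := by have := Real.exp_pos 2; nlinarith
  nlinarith

/-! ### The wuc certificate: 27770 ⟹ S1 (PROVED) -/

/-- Elementary: under the top-band admissibility conditions, `E₀ = max(s/ℓ, 4/L)` satisfies `0 < E₀ ≤ 1`,
`1 ≤ E₀ (2R₂+1)`, `E₀ (2R₂+1) ≤ 3` and `E₀ · R₂ ≤ 1`. -/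
theorem anchor_arith {s ℓ : ℝ} {L R₂ : ℕ} (hs : 0 < s) (hℓ : 0 < ℓ) (hR : 1 ≤ R₂) (hRs : (R₂ : ℝ) * s ≤ ℓ)
    (hL : 4 * R₂ + 8 ≤ L) (hℓR : ℓ < 2 * (R₂ : ℝ) * s) :
    0 < max (s / ℓ) (4 / (L : ℝ)) ∧ max (s / ℓ) (4 / (L : ℝ)) ≤ 1 ∧
    1 ≤ max (s / ℓ) (4 / (L : ℝ)) * ((2 * R₂ + 1 : ℕ) : ℝ) ∧ max (s / ℓ) (4 / (L : ℝ)) * ((2 * R₂ + 1 : ℕ) : ℝ) ≤ 3 ∧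
    max (s / ℓ) (4 / (L : ℝ)) * (R₂ : ℝ) ≤ 1 := by
  have hR' : (1:ℝ) ≤ R₂ := by exact_mod_cast hR
  have hL' : (4:ℝ) * R₂ + 8 ≤ L := by exact_mod_cast hL
  have hLpos : (0:ℝ) < L := by linarith
  have hsl : s / ℓ ≤ 1 := by rw [div_le_one hℓ]; nlinarith
  have h4L : 4 / (L:ℝ) ≤ 1 := by rw [div_le_one hLpos]; linarith
  have hcast : ((2 * R₂ + 1 : ℕ) : ℝ) = 2 * (R₂:ℝ) + 1 := by push_cast; ring
  refine ⟨lt_max_of_lt_left (div_pos hs hℓ), max_le hsl h4L, ?_, ?_, ?_⟩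
  · rw [hcast]
    have h1 : 1 ≤ s / ℓ * (2 * (R₂:ℝ) + 1) := by
      rw [div_mul_eq_mul_div, le_div_iff₀ hℓ]; nlinarith
    exact le_trans h1 (mul_le_mul_of_nonneg_right (le_max_left _ _) (by positivity))
  · rw [hcast]
    rcases le_total (s / ℓ) (4 / (L:ℝ)) with hle | hle
    · rw [max_eq_right hle]
      rw [div_mul_eq_mul_div, div_le_iff₀ hLpos]; nlinarith
    · rw [max_eq_left hle]
      rw [div_mul_eq_mul_div, div_le_iff₀ hℓ]; nlinarith
  · rcases le_total (s / ℓ) (4 / (L:ℝ)) with hle | hle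
    · rw [max_eq_right hle, div_mul_eq_mul_div, div_le_iff₀ hLpos]; nlinarith
    · rw [max_eq_left hle, div_mul_eq_mul_div, div_le_iff₀ hℓ]; nlinarith

/-- **The wuc certificate: `TopBandPointCeiling` (27770) ⟹ the spectral anchor S1** (with `C ↦ e^{3/2}·C`): below the onset
energy `e^{−E(t₂−1)} ≥ e^{−3}`, so `κ₀ + ν([0,E₀)) ≤ e³ c_L(t₂)` by the canonical representation.  PROVED (no sorry). -/
theorem spectralAnchor_of_topBandPointCeiling
    (H : Summit.QuantumFields.YangMills.Theses.ThermodynamicCeilings.TopBandPointCeiling) :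
    ∀ (G : Type) [Group G] [TopologicalSpace G] [IsTopologicalGroup G] [CompactSpace G],
    IsCompactSimpleLieGroup G → Nonempty (G ≃ₜ* Matrix.specialUnitaryGroup (Fin 2) ℂ) →
    letI : MeasurableSpace G := borel G; haveI : BorelSpace G := ⟨rfl⟩;
    ∀ (r : LatticeRep G) (v f g h : SchwartzMap (EuclideanSpace ℝ (Fin 4)) ℝ) (Λ₅ : ℝ), ∃ ε₀ : ℝ, 0 < ε₀ ∧
    ∀ ε : ℝ, 0 < ε → ε ≤ ε₀ → Floors G r v f g h Λ₅ ε → ∃ ℓ₄ : ℝ, 0 < ℓ₄ ∧ ∀ ℓ : ℝ, 0 < ℓ → ℓ ≤ ℓ₄ →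
    ∃ (C β₄ : ℝ), 0 ≤ C ∧ ∀ β : ℝ, β₄ ≤ β → ∀ s : ℝ, 0 < s → s ≤ 1 → OnsetMax G r v f g h Λ₅ ε β s →
    NearOnset G r v f g h Λ₅ ε β s →
    ∀ (L : ℕ) (q : Fin 4 × Fin 4) (k : Fin 4) (R₂ : ℕ), q.1 < q.2 → 1 ≤ R₂ → (R₂ : ℝ) * s ≤ ℓ → 4 * R₂ + 8 ≤ L →
      ℓ < 2 * (R₂ : ℝ) * s →
      canConstant G r β L q k + (canMeasure G r β L q k (Iio (max (s / ℓ) (4 / (L : ℝ))))).toReal ≤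
        (C / (R₂ : ℝ) ^ 4) ^ 2 := by
  intro G _ _ _ _ hG hiso
  letI : MeasurableSpace G := borel G
  haveI : BorelSpace G := ⟨rfl⟩
  intro r v f g h Λ₅
  obtain ⟨ε₀, hε₀, H1⟩ := H G hG hiso r v f g h Λ₅
  refine ⟨ε₀, hε₀, fun ε hε hεle hfl => ?_⟩
  obtain ⟨ℓ₄, hℓ₄, H2⟩ := H1 ε hε hεle hfl
  refine ⟨ℓ₄, hℓ₄, fun ℓ hℓ hℓle => ?_⟩
  obtain ⟨C, β₄, hC, H3⟩ := H2 ℓ hℓ hℓle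
  refine ⟨Real.exp (3 / 2) * C, max β₄ 0, by positivity, ?_⟩
  intro β hβ s hs hs1 hmax hnear L q k R₂ hq hR hRs hL hℓR
  have hβ₄ : β₄ ≤ β := le_trans (le_max_left _ _) hβ
  have hβ0 : 0 ≤ β := le_trans (le_max_right _ _) hβ
  have hc := H3 β hβ₄ s hs hs1 hmax hnear L q k R₂ hq hR hRs hL hℓR
  obtain ⟨hfin, hIic, hκ, hrep⟩ := canonical_representation G r β hβ0 L q k
  have hrep' := hrep (2 * R₂ + 2) (by omega) (by omega)
  obtain ⟨hE₀, hE₀1, h1, h3, hER⟩ := anchor_arith hs hℓ hR hRs hL hℓR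
  set E₀ := max (s / ℓ) (4 / (L : ℝ)) with hE₀def
  set ν := canMeasure G r β L q k with hνdef
  set κ₀ := canConstant G r β L q k with hκdef
  haveI := hfin
  -- the covariance equals the representation; below E₀ the integrand is ≥ e^{-3}
  set τ : ℝ := ((2 * R₂ + 2 : ℕ) : ℝ) - ((1 : ℕ) : ℝ) with hτdef
  set σ : ℝ := ((2 * L + 1 : ℕ) : ℝ) - ((1 : ℕ) : ℝ) - ((2 * R₂ + 2 : ℕ) : ℝ) with hσdef
  have hτeq : τ = ((2 * R₂ + 1 : ℕ) : ℝ) := by rw [hτdef]; push_cast; ring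
  have hτ0 : 0 ≤ τ := by rw [hτeq]; positivity
  have hσ0 : 0 ≤ σ := by
    rw [hσdef]; push_cast
    have : (4:ℝ) * R₂ + 8 ≤ L := by exact_mod_cast hL
    linarith
  have hIτ := exp_integrable ν hIic τ hτ0
  have hIσ := exp_integrable ν hIic σ hσ0
  have hint_ge : Real.exp (-3) * (ν (Iio E₀)).toReal ≤ ∫ E, (Real.exp (-(E * τ)) + Real.exp (-(E * σ))) ∂ν := by
    have hlow : ∫ E in Iio E₀, Real.exp (-3) ∂ν ≤ ∫ E in Iio E₀, (Real.exp (-(E * τ)) + Real.exp (-(E * σ))) ∂ν := by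
      refine setIntegral_mono_on (integrable_const _).integrableOn (hIτ.add hIσ).integrableOn measurableSet_Iio ?_
      intro E hE
      have hElt : E < E₀ := hE
      have hEτ : E * τ ≤ 3 := by
        by_cases hE0 : 0 ≤ E
        · calc E * τ ≤ E₀ * τ := mul_le_mul_of_nonneg_right hElt.le hτ0
            _ ≤ 3 := by rw [hτeq]; exact h3
        · push Not at hE0; nlinarith
      have := Real.exp_pos (-(E * σ))
      have h2 : Real.exp (-3) ≤ Real.exp (-(E * τ)) := Real.exp_le_exp.2 (by linarith)
      linarith
    have hae : 0 ≤ᵐ[ν] fun E => Real.exp (-(E * τ)) + Real.exp (-(E * σ)) :=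
      Filter.Eventually.of_forall fun E => by positivity
    calc Real.exp (-3) * (ν (Iio E₀)).toReal = ∫ E in Iio E₀, Real.exp (-3) ∂ν := by
          rw [setIntegral_const, smul_eq_mul, mul_comm]; rfl
      _ ≤ ∫ E in Iio E₀, (Real.exp (-(E * τ)) + Real.exp (-(E * σ))) ∂ν := hlow
      _ ≤ ∫ E, (Real.exp (-(E * τ)) + Real.exp (-(E * σ))) ∂ν :=
          setIntegral_le_integral (hIτ.add hIσ) hae
  -- assemble: κ₀ + ν(Iio E₀) ≤ e³ (κ₀ + ∫ …) = e³ c ≤ e³ (C/R₂⁴)²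
  have hm0 : 0 ≤ (ν (Iio E₀)).toReal := ENNReal.toReal_nonneg
  have he3 : Real.exp 3 * Real.exp (-3) = 1 := by rw [← Real.exp_add]; norm_num
  have he1 : 1 ≤ Real.exp 3 := Real.one_le_exp (by norm_num)
  have hcov_eq := hrep'
  -- |c| ≤ (C/R₂⁴)² and c = κ₀ + ∫
  have hc' : κ₀ + ∫ E, (Real.exp (-(E * τ)) + Real.exp (-(E * σ))) ∂ν ≤ (C / (R₂ : ℝ) ^ 4) ^ 2 := by
    have := le_trans (le_abs_self _) hc
    rw [hcov_eq] at this
    exact this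
  have hsq : (Real.exp (3 / 2) * C / (R₂ : ℝ) ^ 4) ^ 2 = Real.exp 3 * (C / (R₂ : ℝ) ^ 4) ^ 2 := by
    have : Real.exp (3 / 2) ^ 2 = Real.exp 3 := by rw [← Real.exp_nat_mul]; norm_num
    rw [show Real.exp (3 / 2) * C / (R₂ : ℝ) ^ 4 = Real.exp (3 / 2) * (C / (R₂ : ℝ) ^ 4) by ring, mul_pow, this]
  rw [hsq]
  have hI0 : 0 ≤ ∫ E, (Real.exp (-(E * τ)) + Real.exp (-(E * σ))) ∂ν := integral_nonneg fun E => by positivity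
  calc κ₀ + (ν (Iio E₀)).toReal
      = κ₀ + Real.exp 3 * (Real.exp (-3) * (ν (Iio E₀)).toReal) := by rw [← mul_assoc, he3, one_mul]
    _ ≤ κ₀ + Real.exp 3 * ∫ E, (Real.exp (-(E * τ)) + Real.exp (-(E * σ))) ∂ν := by gcongr
    _ ≤ Real.exp 3 * (κ₀ + ∫ E, (Real.exp (-(E * τ)) + Real.exp (-(E * σ))) ∂ν) := by nlinarith
    _ ≤ Real.exp 3 * (C / (R₂ : ℝ) ^ 4) ^ 2 := mul_le_mul_of_nonneg_left hc' (Real.exp_pos 3).le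

end Summit.QuantumFields.YangMills.Cruxes.TopBandPointCeiling.SpectralAnchor

end
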